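import Mathlib
import Summits.ValiantsHypothesis.ValiantsHypothesis.Theorems.GrenetZeonTwoDimCoefficientsScalingIndexThreeHalves
import Summits.ValiantsHypothesis.ValiantsHypothesis.Theorems.GrenetZeonHessianRankCodimTwoPlaneCriterion

/-!
# Crux `GrenetZeon.TwoDimCoefficients` (stmt-ValiantsHypothesis-8062), stub `stub_dualUnipotent`:
# scaling-closure — ★★★ the PER-FREE HESSIAN-RATE LAW of index-`n` pencils (rate `2m²/n` at EVERY point)

The per-free form of ✓ `cube_le_two_mul_sq_of_index` (memo EIGHTEENTH-HAND.md §A′).  For an index-`n` unipotent pencil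
`A = A₀(1 − N)` (`N` linear, `Nⁿ = 0`, `det A = c ≠ 0`, `n ≥ 2`) and ANY affine numerator matrix `B` — no permanent, no
representation identity — the top numerator `P := [tr(adj A·B)]_n = c·tr(N^{n−1}A₀⁻¹B₁)` obeys, at EVERY point `z`,

  `rank Hess P (z) · n ≤ 2m²`.

This is conjecture (H) `HessianRate` of the route's plan of record (constant `2`) on the whole index-`n` class, and the
interface a restriction / projection argument for general pencils (residual R6) needs: it applies verbatim to `P ∘ π`
for a linear substitution `π` of the variables (the substituted pencil is again index-`n`), where the Mignon–Ressayre
point of `per_n` is no longer available but a lower bound on the Hessian rank is.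

Proof: the numerator-perturbation engine (✓ `rank_hess0_top_le_of_perturbedRay`, ✓ `exists_numerator_direction`,
✓ `rank_map_eval_le_of_infinite`) run at a point `z₀` where a non-zero `ρ`-minor of the polynomial Hessian matrix of `P`
(`ρ = rank Hess P(z)`), a maximal minor of `N^{n−1}` and one coordinate are all non-zero; `ρ ≤ rank Hess P(z₀) ≤ 2m·r`,
`r·n ≤ m` (`r = max rank N^{n−1}`, top companion `[D_r]_{rn} ≠ 0` of degree `≤ m`).

* ★★★ `rank_hess0_top_mul_le_of_index` — the law above.

HONEST FRAMING: a per-free structural law for index-`n` pencils; the stub `DualUnipotentBound`, crux 8062, the 24318 decl for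
general (index `> n`) pencils and `VP ≠ VNP` remain open.

References: T. Mignon, N. Ressayre, Int. Math. Res. Not. 2004:79, Thm. 1.1 (via the tree); folklore.
-/

-- single-conjunct layout `Summits/ValiantsHypothesis/ValiantsHypothesis`: the duplicated namespace
-- component is mandated by the tree.
set_option linter.dupNamespace false
set_option autoImplicit false

noncomputable section

namespace Summit.ValiantsHypothesis.ValiantsHypothesis.Theorems.GrenetZeonTwoDimCoefficients.ScalingClosure

open MvPolynomial Matrix
open Literature.Computability.AlgebraicComplexity
open Summit.ValiantsHypothesis.ValiantsHypothesis.Cruxes.TwoDimCoefficients.DimTwoCases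

section IndexHessianRate

open Summit.ValiantsHypothesis.ValiantsHypothesis.Theorems.GrenetZeon.HessianRankCodimTwo
  (eval_det_submatrix_hessMatrix)

/-- ★★★ **Hessian-rate law of index-`n` pencils.**  For `A = A₀(1 − N)` (`N` linear, `Nⁿ = 0`, `A₀` invertible,
`det A = c ≠ 0`, `n ≥ 2`) and any affine `B`, the top numerator `P = [tr(adj A·B)]_n` satisfies
`rank Hess P(z) · n ≤ 2m²` at every point `z`. [cite: MignonRessayre2004, Thm. 1.1 — via the tree; folklore] -/
theorem rank_hess0_top_mul_le_of_index {n m : ℕ} (hn : 2 ≤ n) (A B : AffMat n m) (hA : IsAffine A)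
    (hB : IsAffine B) (c : ℂ) (hc : c ≠ 0) (hdet : A.det = MvPolynomial.C c)
    (A₀ P₀ : Matrix (Fin m) (Fin m) ℂ) (hP₀ : A₀ * P₀ = 1) (N : AffMat n m)
    (hN : ∀ i j, (N i j).IsHomogeneous 1) (hNn : N ^ n = 0) (hAN : A = A₀.map MvPolynomial.C * (1 - N))
    (z : Fin n × Fin n → ℂ) :
    (hess0 (transl z (homogeneousComponent n ((A.adjugate * B).trace)))).rank * n ≤ 2 * m ^ 2 := by
  classical
  have hu : IsUnit A.det := by rw [hdet]; exact (isUnit_iff_ne_zero.mpr hc).map MvPolynomial.C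
  have hP₀A₀ : P₀ * A₀ = 1 := mul_eq_one_comm.mp hP₀
  set p : MvPolynomial (Fin n × Fin n) ℂ := homogeneousComponent n ((A.adjugate * B).trace) with hp
  -- Step 0: the rank `ρ` at `z`; nothing to do if it vanishes
  set ρ : ℕ := (hess0 (transl z p)).rank with hρdef
  rcases Nat.eq_zero_or_pos ρ with hρ0 | hρpos
  · rw [hρ0, zero_mul]; exact Nat.zero_le _
  obtain ⟨ρ', hρ'⟩ : ∃ ρ', ρ = ρ' + 1 := ⟨ρ - 1, by omega⟩
  obtain ⟨τ₁, τ₂, hτ⟩ := (succ_le_rank_iff_exists_det_submatrix_ne_zero (hess0 (transl z p)) ρ').mp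
    (by rw [← hρ'])
  -- the `ρ`-minor of the polynomial Hessian matrix of `p`
  set H : MvPolynomial (Fin n × Fin n) ℂ :=
    ((Matrix.of fun s t : Fin n × Fin n => pderiv s (pderiv t p)).submatrix τ₁ τ₂).det with hH
  have hHeval : ∀ w : Fin n × Fin n → ℂ, eval w H = ((hess0 (transl w p)).submatrix τ₁ τ₂).det := fun w =>
    eval_det_submatrix_hessMatrix p w τ₁ τ₂
  have hH0 : H ≠ 0 := fun h => hτ (by rw [← hHeval, h, map_zero])
  have hp0 : p ≠ 0 := by
    intro h0
    apply hH0
    rw [hH, h0]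
    have hzero : (Matrix.of fun s t : Fin n × Fin n => pderiv s (pderiv t (0 : MvPolynomial (Fin n × Fin n) ℂ))) = 0 := by
      apply Matrix.ext; intro s t; rw [Matrix.of_apply, map_zero, map_zero, Matrix.zero_apply]
    rw [hzero, Matrix.submatrix_zero, Pi.zero_apply, Pi.zero_apply, Matrix.det_zero]
  -- Step 1: the maximal rank `r` of `N(z)^{n-1}`
  set r : ℕ := Nat.findGreatest (fun j => ∃ w : Fin n × Fin n → ℂ,
    j ≤ ((N.map (eval w)) ^ (n - 1)).rank) m with hrdef
  have hr_spec : ∃ z₁ : Fin n × Fin n → ℂ, r ≤ ((N.map (eval z₁)) ^ (n - 1)).rank :=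
    Nat.findGreatest_spec (P := fun j => ∃ w : Fin n × Fin n → ℂ,
      j ≤ ((N.map (eval w)) ^ (n - 1)).rank) (Nat.zero_le m) ⟨0, Nat.zero_le _⟩
  have hr_max : ∀ w : Fin n × Fin n → ℂ, ((N.map (eval w)) ^ (n - 1)).rank ≤ r := fun w =>
    Nat.le_findGreatest (Matrix.rank_le_width _) ⟨w, le_rfl⟩
  have hrm : r ≤ m := Nat.findGreatest_le m
  -- the companions of `(A, B)`; `r ≥ 1` since `[D_1]_n = p ≠ 0`
  obtain ⟨D, hD⟩ : ∃ D : ℕ → MvPolynomial (Fin n × Fin n) ℂ, ∀ j, D j =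
      (det ((Polynomial.X : Polynomial (MvPolynomial (Fin n × Fin n) ℂ)) •
        B.map Polynomial.C + A.map Polynomial.C)).coeff j := ⟨_, fun _ => rfl⟩
  have hr1 : 1 ≤ r := by
    by_contra h0
    have hz := topCompanion_eq_zero_of_rank_lt (n := n) (by omega) A₀ P₀ hP₀ N hN hNn A hAN c hc hdet B hB
      hr_max D hD (k := 1) (by omega)
    rw [one_mul, hD 1, coeff_det_one A B hu] at hz
    exact hp0 hz
  obtain ⟨z₁, hz₁⟩ := hr_spec
  obtain ⟨r', hr'⟩ : ∃ r', r = r' + 1 := ⟨r - 1, by omega⟩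
  -- Step 2: a non-zero `r`-minor of `N^{n-1}`; the point `z₀`
  obtain ⟨ρ₁, κ, hρκ⟩ := (succ_le_rank_iff_exists_det_submatrix_ne_zero ((N.map (eval z₁)) ^ (n - 1)) r').mp
    (by rw [← hr']; exact hz₁)
  set μ : MvPolynomial (Fin n × Fin n) ℂ := ((N ^ (n - 1)).submatrix ρ₁ κ).det with hμ
  have hμeval : ∀ w : Fin n × Fin n → ℂ,
      eval w μ = (((N.map (eval w)) ^ (n - 1)).submatrix ρ₁ κ).det := by
    intro w
    rw [hμ, RingHom.map_det, RingHom.mapMatrix_apply, ← Matrix.submatrix_map, Matrix.map_pow]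
  have hμ0 : μ ≠ 0 := fun h => hρκ (by rw [← hμeval, h, map_zero])
  set i₀ : Fin n × Fin n := (⟨0, by omega⟩, ⟨0, by omega⟩) with hi₀
  obtain ⟨z₀, hz₀⟩ := exists_eval_ne_zero_of_ne_zero (H * μ * X i₀)
    (mul_ne_zero (mul_ne_zero hH0 hμ0) (X_ne_zero i₀))
  rw [map_mul, map_mul, MvPolynomial.eval_X] at hz₀
  have hHz : eval z₀ H ≠ 0 := fun h => hz₀ (by rw [h, zero_mul, zero_mul])
  have hμz : eval z₀ μ ≠ 0 := fun h => hz₀ (by rw [h, mul_zero, zero_mul])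
  have hz00 : z₀ i₀ ≠ 0 := fun h => hz₀ (by rw [h, mul_zero])
  set N₀ : Matrix (Fin m) (Fin m) ℂ := (N.map (eval z₀)) ^ (n - 1) with hN₀
  have hN₀r : N₀.rank = r := by
    refine le_antisymm (hr_max z₀) ?_
    rw [hr']
    exact (succ_le_rank_iff_exists_det_submatrix_ne_zero N₀ r').mpr ⟨ρ₁, κ, by rw [hN₀, ← hμeval]; exact hμz⟩
  -- the rank of `Hess p` at `z₀` is at least `ρ`
  set Hp : Matrix (Fin n × Fin n) (Fin n × Fin n) ℂ := hess0 (transl z₀ p) with hHpdef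
  have hρle : ρ ≤ Hp.rank := by
    rw [hρ']
    exact (succ_le_rank_iff_exists_det_submatrix_ne_zero Hp ρ').mpr ⟨τ₁, τ₂, by rw [hHpdef, ← hHeval]; exact hHz⟩
  -- Step 3: the numerator direction
  set B1 : AffMat n m := Matrix.of fun a b => homogeneousComponent 1 (B a b) with hB1
  set M₀ : Matrix (Fin m) (Fin m) ℂ := P₀ * B1.map (eval z₀) with hM₀
  obtain ⟨K, hK⟩ := exists_numerator_direction N₀ M₀ c hc
  set Cmat : AffMat n m :=
    (X i₀ * MvPolynomial.C (z₀ i₀)⁻¹ : MvPolynomial (Fin n × Fin n) ℂ) • (A₀ * K).map MvPolynomial.C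
    with hCmat
  have hCentry : ∀ a b, Cmat a b = X i₀ * MvPolynomial.C ((z₀ i₀)⁻¹ * (A₀ * K) a b) := by
    intro a b
    rw [hCmat, Matrix.smul_apply, Matrix.map_apply, smul_eq_mul, map_mul, mul_assoc]
  have hChom : ∀ a b, (Cmat a b).IsHomogeneous 1 := fun a b => by
    rw [hCentry]
    simpa using (isHomogeneous_X ℂ i₀).mul (isHomogeneous_C (Fin n × Fin n) ((z₀ i₀)⁻¹ * (A₀ * K) a b))
  set Bθ : ℂ → AffMat n m := fun θ => (MvPolynomial.C θ : MvPolynomial (Fin n × Fin n) ℂ) • B + Cmat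
    with hBθ
  have hBθentry : ∀ θ a b, Bθ θ a b = MvPolynomial.C θ * B a b + Cmat a b := fun θ a b => by
    rw [hBθ]; simp only [Matrix.add_apply, Matrix.smul_apply, smul_eq_mul]
  have hBθaff : ∀ θ, IsAffine (Bθ θ) := by
    intro θ a b
    rw [hBθentry]
    refine (totalDegree_add _ _).trans (max_le ?_ (hChom a b).totalDegree_le)
    exact (totalDegree_mul _ _).trans (by rw [totalDegree_C, zero_add]; exact hB a b)
  -- linear parts at `z₀`
  have hlin : ∀ θ : ℂ, P₀ * (Matrix.of fun a b => homogeneousComponent 1 (Bθ θ a b)).map (eval z₀) = θ • M₀ + K := by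
    intro θ
    have h1 : (Matrix.of fun a b => homogeneousComponent 1 (Bθ θ a b)).map (eval z₀) =
        θ • B1.map (eval z₀) + A₀ * K := by
      apply Matrix.ext; intro a b
      rw [Matrix.map_apply, Matrix.of_apply, hBθentry, map_add, homogeneousComponent_C_mul,
        homogeneousComponent_eq_self (hChom a b), map_add, map_mul, MvPolynomial.eval_C, hCentry, map_mul,
        MvPolynomial.eval_X, MvPolynomial.eval_C, ← mul_assoc, mul_inv_cancel₀ hz00, one_mul, Matrix.add_apply,
        Matrix.smul_apply, Matrix.map_apply, hB1, Matrix.of_apply, smul_eq_mul]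
    rw [h1, Matrix.mul_add, Matrix.mul_smul, ← Matrix.mul_assoc, hP₀A₀, Matrix.one_mul]
  -- the top first companion of `(A, Bθ)`
  set q : MvPolynomial (Fin n × Fin n) ℂ := homogeneousComponent n ((A.adjugate * Cmat).trace) with hq
  have htop1 : ∀ θ : ℂ, homogeneousComponent n
      ((det ((Polynomial.X : Polynomial (MvPolynomial (Fin n × Fin n) ℂ)) •
        (Bθ θ).map Polynomial.C + A.map Polynomial.C)).coeff 1) = MvPolynomial.C θ * p + q := by
    intro θ
    rw [coeff_det_one A (Bθ θ) hu, hBθ]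
    simp only
    rw [Matrix.mul_add, Matrix.mul_smul, Matrix.trace_add, Matrix.trace_smul, smul_eq_mul, map_add,
      homogeneousComponent_C_mul]
  -- Hessians at `z₀`
  set Hq : Matrix (Fin n × Fin n) (Fin n × Fin n) ℂ := hess0 (transl z₀ q) with hHqdef
  have hHθ : ∀ θ : ℂ, hess0 (transl z₀ (MvPolynomial.C θ * p + q)) = θ • Hp + Hq := by
    intro θ
    rw [map_add, map_add, map_mul, transl_C, hess0_C_mul]
  -- Step 4: the engine for the good parameters
  set S : Set ℂ := {θ : ℂ | ∃ t : Fin N₀.rank → ℂ, Function.Injective t ∧ (∀ i, t i ≠ 0) ∧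
      (∀ i, (Polynomial.C c * (-(N₀ * (θ • M₀ + K))).charpolyRev).eval (t i) = 0) ∧
      (∀ i, (Polynomial.derivative (Polynomial.C c * (-(N₀ * (θ • M₀ + K))).charpolyRev)).eval (t i) ≠ 0) ∧
      (Polynomial.C c * (-(N₀ * (θ • M₀ + K))).charpolyRev).coeff N₀.rank ≠ 0} with hS
  have hSinf : S.Infinite := hK
  have hgood : ∀ θ ∈ S, (θ • Hp + Hq).rank ≤ r * (2 * m) ∧ r * n ≤ m := by
    intro θ hθ
    obtain ⟨t, ht, ht0, hroot, hder, hcoeff⟩ := hθ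
    have hRz : Polynomial.C c * (-(N₀ * (θ • M₀ + K))).charpolyRev =
        Polynomial.C c * (-(((N.map (eval z₀)) ^ (n - 1)) *
          (P₀ * (Matrix.of fun a b => homogeneousComponent 1 (Bθ θ a b)).map (eval z₀)))).charpolyRev := by
      rw [hlin θ]
    constructor
    · have h := rank_hess0_top_le_of_perturbedRay (n := n) hn A₀ P₀ hP₀ N hN hNn A hAN hA c hc hdet
        (Bθ θ) (hBθaff θ) hr1 hrm hr_max z₀ (t ∘ Fin.cast hN₀r.symm)
        (ht.comp (Fin.cast_injective _)) (fun i => ht0 _) _ hRz (fun i => hroot _) (fun i => hder _)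
      rwa [htop1 θ, hHθ θ] at h
    · -- `[D^θ_r]_{rn} ≠ 0` and `deg D^θ_r ≤ m`
      have hev := eval_topCompanion_eq_coeff (n := n) (by omega) A₀ P₀ hP₀ N hN hNn A hAN c hc hdet (Bθ θ)
        (hBθaff θ) z₀ r
      rw [← hRz, ← hN₀r] at hev
      have hne : homogeneousComponent (N₀.rank * n)
          ((det ((Polynomial.X : Polynomial (MvPolynomial (Fin n × Fin n) ℂ)) •
            (Bθ θ).map Polynomial.C + A.map Polynomial.C)).coeff N₀.rank) ≠ 0 := by
        intro h0
        rw [h0, map_zero] at hev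
        exact hcoeff hev.symm
      rw [← hN₀r]
      by_contra hlt
      push Not at hlt
      refine hne (homogeneousComponent_eq_zero _ _ ?_)
      have hdeg := totalDegree_coeff_det_le A (Bθ θ) hA (hBθaff θ) N₀.rank
      rw [Fintype.card_fin] at hdeg
      omega
  -- Step 5: specialisation `θ → ∞`, i.e. `s = θ⁻¹ → 0`
  obtain ⟨θ₁, hθ₁⟩ := hSinf.nonempty
  have hrn : r * n ≤ m := (hgood θ₁ hθ₁).2
  set S' : Set ℂ := (fun θ : ℂ => θ⁻¹) '' (S \ {0}) with hS'
  have hS'inf : S'.Infinite :=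
    (hSinf.sdiff (Set.finite_singleton 0)).image inv_injective.injOn
  set Mτ : Matrix (Fin n × Fin n) (Fin n × Fin n) (Polynomial ℂ) :=
    Hp.map Polynomial.C + (Polynomial.X : Polynomial ℂ) • Hq.map Polynomial.C with hMτ
  have hMτev : ∀ s : ℂ, Mτ.map (Polynomial.eval s) = Hp + s • Hq := by
    intro s
    apply Matrix.ext; intro a b
    simp only [hMτ, Matrix.map_apply, Matrix.add_apply, Matrix.smul_apply, smul_eq_mul, Polynomial.eval_add,
      Polynomial.eval_C, Polynomial.eval_mul, Polynomial.eval_X]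
  have hS'rank : ∀ s ∈ S', (Mτ.map (Polynomial.eval s)).rank ≤ r * (2 * m) := by
    rintro s ⟨θ, ⟨hθS, hθ0⟩, rfl⟩
    have hθ0' : θ ≠ 0 := hθ0
    have hsm : Hp + θ⁻¹ • Hq = θ⁻¹ • (θ • Hp + Hq) := by
      rw [smul_add, smul_smul, inv_mul_cancel₀ hθ0', one_smul]
    rw [hMτev, hsm, rank_smul_eq (inv_ne_zero hθ0')]
    exact (hgood θ hθS).1
  have hHp_le : Hp.rank ≤ r * (2 * m) := by
    have h := rank_map_eval_le_of_infinite Mτ hS'inf hS'rank 0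
    rwa [hMτev, zero_smul, add_zero] at h
  -- Step 6: arithmetic
  calc ρ * n ≤ (r * (2 * m)) * n := Nat.mul_le_mul_right _ (hρle.trans hHp_le)
    _ = 2 * m * (r * n) := by ring
    _ ≤ 2 * m * m := Nat.mul_le_mul_left _ hrn
    _ = 2 * m ^ 2 := by ring

end IndexHessianRate

end Summit.ValiantsHypothesis.ValiantsHypothesis.Theorems.GrenetZeonTwoDimCoefficients.ScalingClosure

end
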